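/-
Copyright (c) 2026 the pub-hodgecm-mathlib formalisation cell (harness21).  Prover seat hodgecm-mathlib-K2E3-p05 (g3), Track B «K2-LIT», engine E3, unit U4 «Keys»,
2026-09-04.  KERNEL module: THEOREMS ONLY (no definition, no named fact, no `sorry`, no instance, no notation).
-/
import Summits.HodgeConjecture.HodgeConjecture.Theorems.K2E3PSIwahoriBasis             -- ★ II-1 p855550 (this base, g0): the (G3) letters; brings ★ StLevelsTransport (`coe_eA_apply`, `eA_symm_mem_borel`, `eA_vec`, `mem_comap_iff`), ★ BruhatIwahoriThree
import Summits.HodgeConjecture.HodgeConjecture.Theorems.F0P2oBorelTorusModulus           -- ★ `rootDeltaChar_cmBorel_eq_unitModulusChar` (`δ_B^{1∕2}(p) = ‖p₀₀‖`)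
import Literature.NumberTheory.Automorphic.UnitaryParahoricLevelsGenerateThree            -- ★ `exists_mem_torusU_coe_eq_mul_weylLongU_mem_conj_glInt` (`d = diag(ϖ⁻¹,1,σϖ)`, `d·w ∈ K₁`, matrix exported)
import Literature.NumberTheory.Automorphic.CMPrincipalSeriesSpherical                   -- ★ `coe_torusEntry_proj_borelTriple` (`(proj p)ᵢᵢ = pᵢᵢ`)
import Literature.NumberTheory.Automorphic.LocalRingUnitModulusProduct                  -- ★ `unitModulusChar_localRing_eq_prod` (`‖u‖ = Π_w |u_w|_w`)
import Literature.NumberTheory.Automorphic.AddCharConductorExponent                     -- ★ `normAbs_eq_inv_of_valued_eq_exp_neg_one` (`|ϖ|_w = q_w⁻¹`)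
import Literature.NumberTheory.Automorphic.AdicCompletionResidueCard                    -- ★ `residueFieldCard_adicCompletion_eq` (`q_{L_w} = N(w)`)
import Literature.NumberTheory.Automorphic.Liu2021.LemD1AsPrintedIndexedNonVacuityInertFrobenius   -- ★ `card_residueField_eq_sq` (`N(w) = q_v²` at an inert place)
import HarnessLib

/-!
# K2 ∕ E3 «EllipticInputs», unit U4 «Keys» — Road II of MEMO `hK-KeysThmTwo`, assembly II-4, brick «THE EXPLICIT `K₁`-SCALAR»: a Borel `d` with `d·w̃ ∈ K₁` whose
# first diagonal entry is `ϖ⁻¹`, `δ_B^{1∕2}(d) = ‖d₀₀‖ = q_v²`; the transversal count `|R| = [K : K ∩ I]`   [BruhatTits1972 (4.4.3); Casselman1980 §3; WeilBNT1967 I §4]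

Cell hodgecm-mathlib (D-0151), FLOOR 0, Track B «K2-LIT», engine E3, crux item H413 = stmt-HodgeConjecture-24833 (route `HCCMUnconditional`, no route verbs); target BY NAME
`…K2E3EllipticInputs.U4Keys.sig_K2E3KeysThmTwoContracting` (U4-f, U4Keys ED. 4), unramified first rung (Road II of MEMO `K2/K2E3-p05/g2/MEMO-hK-KeysThmTwo-v3`), step 5
of the II-4 assembly.  Author K2E3-p05 (g3).  `--supports stmt-HodgeConjecture-24833 --as helper`; THEOREMS ONLY; letters of ★ (G3)-EXPLICIT ∕ ★ PS-LEVELS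
(`w hw eA heA hd g₁ hg₁ K1 hK1`; `v` inert: `hd : UnramifiedLocalConjDatum`).

THE MATHEMATICS.  ★ II-1 `add_smul_mem_fixedPoints_K1` ∕ ★ II-2b `avgProj_K1_eq` express the `K₁`-spherical line and the `K₁`-average of an unramified `i_G(χ)` through the
scalar `μ = χ(proj d)·δ_B^{1∕2}(d)` for ANY Borel `d` with `d·w̃ ∈ K₁` (★ II-1 `exists_borel_mul_weyl_mem_K1`, existential).  The assembly II-4 needs the VALUE of `μ`, so this
file produces an EXPLICIT such `d`: the pull-back along the one-place model `eA` of the torus element `diag(ϖ⁻¹, 1, σϖ) = diag(ϖ⁻¹, 1, ϖ)` of `U(σ_w, Φ₃)(L_w)` (the element of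
★ `exists_mem_torusU_coe_eq_mul_weylLongU_mem_conj_glInt`, matrix exported), and reads off (§2): `(proj d)₀₀ = d₀₀ =: a` with `a_w = ϖ⁻¹` (★ `coe_torusEntry_proj_borelTriple`,
★ `coe_eA_apply`), so `a⁻¹` is a uniformiser unit of `E_v = Π_{w∣v} L_w` (one factor at a non-split `v`, ★ `PlacesOver.subsingleton_of_smul_eq`), and `δ_B^{1∕2}(d) = ‖a‖`
(★ `rootDeltaChar_cmBorel_eq_unitModulusChar`).  §3: `‖ϖ_E‖ = q_v⁻²` for every uniformiser unit at an INERT place (`‖u‖ = Π_w |u_w|_w` ★, `|ϖ|_w = q_w⁻¹` ★, `q_w = N(w) = q_v²` ★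
`card_residueField_eq_sq`), whence `μ = χ₁(ϖ_E)⁻¹·χ₂(1)·q_v² ` for an unramified pair `(χ₁, χ₂)` in the assembly.  §1: a finite left transversal `R` of `K ∕ (K ∩ I)` has
`|R| = [K : K ∩ I]` (bijection with `K ⧸ (K ⊓ I)`), so that ★ `UnitaryLatticeTreeLevelIndices.index_inf_subgroupOf_eq_of_unramified` (`q³ + 1`, `q + 1`) prices the `|R|`, `|R′|`
of ★ II-2a ∕ II-2b.
HONEST LABEL: HC_CM is proved only modulo the 7 printed citations (2 remaining named inputs: hLiu418 = stmt-HodgeConjecture-24832, h413 = stmt-HodgeConjecture-24833)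
until rung 0 closes; count-neutral (a brick of the first rung of the row-#5 residue; no printed citation is discharged).

## References
* [BruhatTits1972] F. Bruhat, J. Tits, Publ. Math. IHÉS 41 (1972), (4.4.3) (`K₁ = Stab(g₁L₀)`, `d·w ∈ K₁`).  * [Tits1979] J. Tits, PSPM 33.1 (1979), §2.4, §3.3.2.
* [Casselman1980] W. Casselman, Compositio Math. 40 (1980), §3 (the `K`-spherical vectors `φ_K` on the Iwahori plane).
* [WeilBNT1967] A. Weil, *Basic Number Theory* (1967), Ch. I §4 (`K^× = ϖ^ℤ × 𝒪^×`, `mod(ϖ) = q⁻¹`).  * [Rogawski1990] J. D. Rogawski, Ann. of Math. Stud. 123 (1990), §12.1 p. 171, §12.2 p. 173.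
-/

set_option autoImplicit false
-- the mandated namespace has the single-problem summit's repeated segment (`HodgeConjecture.HodgeConjecture`)
set_option linter.dupNamespace false

noncomputable section

open NumberField IsDedekindDomain MeasureTheory
open scoped Matrix MatrixGroups NNReal WithZero
open Literature.NumberTheory Literature.NumberTheory.Automorphic Literature.NumberTheory.Automorphic.UnitaryGroup
open Literature.NumberTheory.Rogawski1990 Literature.NumberTheory.GaloisRepresentations
open Literature.NumberTheory.GaloisRepresentations.IsNonarchimedeanLocalField

namespace Summit.HodgeConjecture.HodgeConjecture.Cruxes.H413.K2E3IwahoriScalarExplicit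

open Summit.HodgeConjecture.HodgeConjecture.Cruxes.H413
open Summit.HodgeConjecture.HodgeConjecture.Cruxes.H413.F0P3cStCharTSStLevelsTransport

/-! ## §1 A finite left transversal of `K ∕ (K ∩ I)` has `[K : K ∩ I]` elements -/

/-- **`|R| = [B : B ∩ S]`** for a finite left transversal `R` of `B` modulo `B ⊓ S` (★ `IsLeftTransversal`): `r ↦ r·(B ⊓ S)` is a bijection `R ≃ B ⧸ (B ⊓ S)`. [folklore] -/
theorem card_eq_index_of_isLeftTransversal {G : Type*} [Group G] {B S : Subgroup G} {R : Finset G}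
    (hR : IsLeftTransversal B (B ⊓ S) R) : R.card = ((B ⊓ S).subgroupOf B).index := by
  classical
  let f : ↥R → ↥B ⧸ (B ⊓ S).subgroupOf B := fun r => QuotientGroup.mk ⟨r.1, hR.mem_of_mem r.1 r.2⟩
  have hf : Function.Bijective f := by
    constructor
    · rintro ⟨r, hr⟩ ⟨r', hr'⟩ h
      have h' : (⟨r, hR.mem_of_mem r hr⟩ : ↥B)⁻¹ * ⟨r', hR.mem_of_mem r' hr'⟩ ∈ (B ⊓ S).subgroupOf B := QuotientGroup.eq.1 h
      rw [Subgroup.mem_subgroupOf, Subgroup.coe_mul, Subgroup.coe_inv] at h'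
      obtain ⟨r₀, -, huniq⟩ := hR.existsUnique r' (hR.mem_of_mem r' hr')
      have e1 : r = r₀ := huniq r ⟨hr, h'⟩
      have e2 : r' = r₀ := huniq r' ⟨hr', by rw [inv_mul_cancel]; exact Subgroup.one_mem _⟩
      exact Subtype.ext (e1.trans e2.symm)
    · intro q
      obtain ⟨x, rfl⟩ := QuotientGroup.mk_surjective q
      obtain ⟨r, ⟨hr, hrx⟩, -⟩ := hR.existsUnique x.1 x.2
      refine ⟨⟨r, hr⟩, ?_⟩
      apply QuotientGroup.eq.2
      rw [Subgroup.mem_subgroupOf, Subgroup.coe_mul, Subgroup.coe_inv]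
      exact hrx
  rw [Subgroup.index, ← Nat.card_eq_of_bijective f hf, Nat.card_eq_fintype_card, Fintype.card_coe]

/-! ## §2 The explicit Borel `d` of `G_v` with `d·w̃ ∈ K₁`: `(proj d)₀₀ = d₀₀ = ϖ⁻¹` at `w`, `δ_B^{1∕2}(d) = ‖d₀₀‖` -/

variable (L : Type) [Field L] [NumberField L] [IsCMField L] (v : HeightOneSpectrum (𝓞 ↥(maximalRealSubfield L)))
  (w : PlacesOver L v) (hw : IsCMField.complexConj L • w.1 = w.1)
  (eA : Gqs L v ≃ₜ* ↥(unitaryGroupOfForm (galAdicCompletionMap (L := L) (IsCMField.complexConj L) hw) ((StdForm.antidiagonal 3).over (w.1.adicCompletion L))))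
  (heA : ∀ g : Gqs L v,
    ((eA g : ↥(unitaryGroupOfForm (galAdicCompletionMap (L := L) (IsCMField.complexConj L) hw) ((StdForm.antidiagonal 3).over (w.1.adicCompletion L)))) : GL (Fin 3) (w.1.adicCompletion L)) =
      ((localNonsplitEquiv (IsCMField.complexConj L) (qsForm L) (IsCMField.complexConj_ne_one L) w hw g :
        ↥(unitaryGroupOfForm (galAdicCompletionMap (L := L) (IsCMField.complexConj L) hw) (placeForm (qsForm L) w.1))) : GL (Fin 3) (w.1.adicCompletion L)))

include heA in
set_option maxHeartbeats 3200000 in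
set_option synthInstance.maxHeartbeats 400000 in
-- instance-path unification between `Gqs L v` and the matrix carrier of ★ `cmBorelTriple` (class of ★ II-1 §4)
/-- **THE EXPLICIT `d`.**  There is a Borel `d ∈ B_v` with `d·w̃ ∈ K₁` (`w̃ = eA⁻¹w`; the binder `d hdK1` of ★ II-1 `add_smul_mem_fixedPoints_K1` ∕ ★ II-2b `avgProj_K1_eq`)
such that, writing `a := (proj d)₀₀ ∈ E_vˣ`: `a_w = ϖ⁻¹`, `a⁻¹` is a uniformiser unit of `E_v` (`|a⁻¹_{w′}|_{w′} = exp(−1)` at every `w′ ∣ v`), and `δ_B^{1∕2}(d) = ‖a‖`.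
(`d = eA⁻¹ diag(ϖ⁻¹, 1, ϖ)`, ★ `exists_mem_torusU_coe_eq_mul_weylLongU_mem_conj_glInt`; ★ `coe_torusEntry_proj_borelTriple`, ★ `coe_eA_apply`, ★ `rootDeltaChar_cmBorel_eq_unitModulusChar`.)
[cite: BruhatTits1972, (4.4.3)] [cite: Casselman1980, §3] [cite: Rogawski1990, §12.1 p. 171] -/
theorem exists_borel_mul_weyl_mem_K1_explicit {ϖ : w.1.adicCompletion L}
    (hd : HermitianLattice.UnramifiedLocalConjDatum (galAdicCompletionMap (L := L) (IsCMField.complexConj L) hw) ϖ)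
    (g₁ : GL (Fin 3) (w.1.adicCompletion L)) (hg₁ : (g₁ : Matrix (Fin 3) (Fin 3) (w.1.adicCompletion L)) = Matrix.diagonal ![(1 : w.1.adicCompletion L), 1, ϖ])
    (K1 : Subgroup (Gqs L v))
    (hK1 : K1 = (((glInt 3 (w.1.adicCompletion L)).map (MulAut.conj g₁).toMonoidHom).subgroupOf
      (unitaryGroupOfForm (galAdicCompletionMap (L := L) (IsCMField.complexConj L) hw) ((StdForm.antidiagonal 3).over (w.1.adicCompletion L)))).comap
        eA.toMulEquiv.toMonoidHom) :
    ∃ d : ↥(cmBorelTriple L 3 v).P,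
      (d : ↥(unitaryGroupOfForm (conjLocal L (IsCMField.complexConj L) v) (cmLocalForm L 3 v))) *
          (![(1 : ↥(unitaryGroupOfForm (conjLocal L (IsCMField.complexConj L) v) (cmLocalForm L 3 v))),
            eA.symm (weylLongU (galAdicCompletionMap (L := L) (IsCMField.complexConj L) hw) (rfl : (StdForm.antidiagonal 3).over (w.1.adicCompletion L) = _))] 1) ∈ K1 ∧
      ((torusEntry (conjLocal L (IsCMField.complexConj L) v) (cmLocalForm L 3 v) 0 ((cmBorelTriple L 3 v).proj d) : (LocalRing L v)ˣ) : LocalRing L v) w = ϖ⁻¹ ∧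
      (∀ w' : PlacesOver L v, Valued.v ((((torusEntry (conjLocal L (IsCMField.complexConj L) v) (cmLocalForm L 3 v) 0 ((cmBorelTriple L 3 v).proj d))⁻¹ :
          (LocalRing L v)ˣ) : LocalRing L v) w') = WithZero.exp (-1 : ℤ)) ∧
      (haveI := locallyCompactSpace_cmBorelU L 3 v; ((rootDeltaChar (cmBorelTriple L 3 v).P d : ℂˣ) : ℂ)) =
        ((unitModulusChar (LocalRing L v) (torusEntry (conjLocal L (IsCMField.complexConj L) v) (cmLocalForm L 3 v) 0 ((cmBorelTriple L 3 v).proj d)) : ℝ≥0) : ℝ) := by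
  haveI : Subsingleton (PlacesOver L v) := PlacesOver.subsingleton_of_smul_eq (IsCMField.complexConj L) (IsCMField.complexConj_ne_one L) w hw
  obtain ⟨dm, hdT, hdmat, hdw⟩ := exists_mem_torusU_coe_eq_mul_weylLongU_mem_conj_glInt (galAdicCompletionMap (L := L) (IsCMField.complexConj L) hw)
    (rfl : (StdForm.antidiagonal 3).over (w.1.adicCompletion L) = _) hd.σσ hd.vσ hd.vϖ g₁ hg₁
  set d : ↥(cmBorelTriple L 3 v).P := ⟨eA.symm dm, eA_symm_mem_borel L v w hw eA heA (torusU_le_borelU _ _ hdT)⟩ with hddef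
  -- the first diagonal entry of `d` at `w` is that of `dm = eA d`, i.e. `ϖ⁻¹`
  have hentry : ((torusEntry (conjLocal L (IsCMField.complexConj L) v) (cmLocalForm L 3 v) 0 ((cmBorelTriple L 3 v).proj d) : (LocalRing L v)ˣ) : LocalRing L v) w = ϖ⁻¹ := by
    rw [coe_torusEntry_proj_borelTriple]
    have h := coe_eA_apply L v w hw eA heA (eA.symm dm) 0 0
    rw [ContinuousMulEquiv.apply_symm_apply, hdmat] at h
    have h00 : (!![ϖ⁻¹, 0, 0; 0, 1, 0; 0, 0, galAdicCompletionMap (L := L) (IsCMField.complexConj L) hw ϖ] : Matrix (Fin 3) (Fin 3) (w.1.adicCompletion L)) 0 0 = ϖ⁻¹ := rfl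
    rw [h00] at h
    exact h.symm
  refine ⟨d, ?_, hentry, fun w' => ?_, ?_⟩
  · -- `d·w̃ ∈ K1`: `eA (d w̃) = dm·w ∈ g₁GL₃(𝒪)g₁⁻¹`
    subst hK1
    let eU : ↥(unitaryGroupOfForm (conjLocal L (IsCMField.complexConj L) v) (cmLocalForm L 3 v)) ≃ₜ* ↥(unitaryGroupOfForm (galAdicCompletionMap (L := L) (IsCMField.complexConj L) hw) ((StdForm.antidiagonal 3).over (w.1.adicCompletion L))) := eA
    have hmem : eU (eU.symm dm * (![(1 : ↥(unitaryGroupOfForm (conjLocal L (IsCMField.complexConj L) v) (cmLocalForm L 3 v))), eA.symm (weylLongU (galAdicCompletionMap (L := L) (IsCMField.complexConj L) hw) (rfl : (StdForm.antidiagonal 3).over (w.1.adicCompletion L) = _))] 1)) ∈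
        ((glInt 3 (w.1.adicCompletion L)).map (MulAut.conj g₁).toMonoidHom).subgroupOf
          (unitaryGroupOfForm (galAdicCompletionMap (L := L) (IsCMField.complexConj L) hw) ((StdForm.antidiagonal 3).over (w.1.adicCompletion L))) := by
      rw [map_mul, ContinuousMulEquiv.apply_symm_apply, eA_vec L v w hw eA 1]
      exact hdw
    exact (mem_comap_iff L v w hw eA _ _).2 hmem
  · -- `a⁻¹` is a uniformiser unit (one place above `v`)
    obtain rfl : w' = w := Subsingleton.elim _ _
    rw [Units.val_inv_eq_inv_val, Pi.inv_apply, hentry, inv_inv]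
    exact hd.vϖ
  · -- `δ_B^{1∕2}(d) = ‖d₀₀‖ = ‖(proj d)₀₀‖`
    rw [F0P2oBorelTorusModulus.rootDeltaChar_cmBorel_eq_unitModulusChar L v d]
    congr 3
    apply Units.ext
    rw [coe_diagEntry, coe_torusEntry_proj_borelTriple]

/-! ## §3 `‖ϖ_E‖ = q_v⁻²` for a uniformiser unit of `E_v` at an inert place -/

/-- **`‖ϖ_E‖ = q_v⁻²`**: at a non-split place `v` of `L⁺` unramified in `L`, every uniformiser unit `ϖ_E` of `E_v = Π_{w∣v} L_w` (one factor) has module `(q_v²)⁻¹`,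
`q_v = #(𝓞_{L⁺}∕v)` — `‖u‖ = Π_w |u_w|_w` (★), `|ϖ|_w = q_w⁻¹` (★), `q_w = N(w) = q_v²` (★ `card_residueField_eq_sq`, `f(w|v) = 2`).
[cite: WeilBNT1967, Ch. I §4] [cite: NeukirchANT1999, Ch. I §8 Prop. (8.2)] -/
theorem unitModulusChar_uniformizer_eq_inv_sq (hns : ∀ w' : PlacesOver L v, IsCMField.complexConj L • w'.1 = w'.1)
    (hunr : Algebra.IsUnramifiedIn (𝓞 L) v.asIdeal)
    (ϖE : (LocalRing L v)ˣ) (hϖE : ∀ w' : PlacesOver L v, Valued.v ((ϖE : LocalRing L v) w') = WithZero.exp (-1 : ℤ)) :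
    unitModulusChar (LocalRing L v) ϖE = ((Nat.card (𝓞 ↥(maximalRealSubfield L) ⧸ v.asIdeal) ^ 2 : ℕ) : ℝ≥0)⁻¹ := by
  obtain ⟨w⟩ : Nonempty (PlacesOver L v) := inferInstance
  haveI : Subsingleton (PlacesOver L v) := PlacesOver.subsingleton_of_smul_eq (IsCMField.complexConj L) (IsCMField.complexConj_ne_one L) w (hns w)
  haveI : Algebra.IsQuadraticExtension ↥(maximalRealSubfield L) L := IsCMField.isQuadraticExtension L
  rw [unitModulusChar_localRing_eq_prod, Fintype.prod_subsingleton _ w, normAbs_eq_inv_of_valued_eq_exp_neg_one w.1 (hϖE w),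
    residueFieldCard_adicCompletion_eq, IsDedekindDomain.HeightOneSpectrum.residueCard_eq_card_quotient,
    Liu2021.LemD1IndexedNonVacuityInertFrobenius.card_residueField_eq_sq L (IsCMField.complexConj L) v (IsCMField.complexConj_ne_one L) hunr w (hns w)]

/-- The same as a complex number: `‖ϖ_E‖ = (q_v²)⁻¹` in `ℂ` (the currency of ★ II-2a∕II-2b's scalars). [cite: WeilBNT1967, Ch. I §4] -/
theorem coe_unitModulusChar_uniformizer_eq (hns : ∀ w' : PlacesOver L v, IsCMField.complexConj L • w'.1 = w'.1)
    (hunr : Algebra.IsUnramifiedIn (𝓞 L) v.asIdeal)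
    (ϖE : (LocalRing L v)ˣ) (hϖE : ∀ w' : PlacesOver L v, Valued.v ((ϖE : LocalRing L v) w') = WithZero.exp (-1 : ℤ)) :
    (((unitModulusChar (LocalRing L v) ϖE : ℝ≥0) : ℝ) : ℂ) = ((Nat.card (𝓞 ↥(maximalRealSubfield L) ⧸ v.asIdeal) : ℂ) ^ 2)⁻¹ := by
  rw [unitModulusChar_uniformizer_eq_inv_sq L v hns hunr ϖE hϖE, NNReal.coe_inv, Complex.ofReal_inv, NNReal.coe_natCast, Complex.ofReal_natCast, Nat.cast_pow]

end Summit.HodgeConjecture.HodgeConjecture.Cruxes.H413.K2E3IwahoriScalarExplicit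

end
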